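import Literature.NumberTheory.DiophantineGeometry.MinimalDiscriminantSpanProofs
import HarnessLib

/-!
# The minimal discriminant of a Weierstrass curve — `N (𝔇_min) = |Δ|` over `ℤ`

Discharge of the named fact `WeierstrassCurve.minimalDiscriminantNorm_eq_natAbs` stated in
`Literature.NumberTheory.DiophantineGeometry.MinimalDiscriminant` (kept in a sibling file so that
the statement file stays a definitions/named-facts file; it is the `A = ℤ` corollary of
`WeierstrassCurve.minimalDiscriminantIdeal_eq_span_holds` in `MinimalDiscriminantSpanProofs`, which
this file imports), together with the discharge of the neighbouring per-place fact
`WeierstrassCurve.valuation_Δ_eq_of_isMinimalAt`.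

* `WeierstrassCurve.minimalDiscriminantNorm_eq_natAbs_holds`: over `ℤ ⊆ ℚ`, an integral
  Weierstrass equation `W₀ / ℤ` with `Δ ≠ 0` that is minimal at every prime has
  `N (𝔇_min) = |Δ (W₀)|` (Silverman, AEC VIII.8, PDF p. 211: for a global minimal equation
  `𝒟_{E/K} = (Δ)`; over `ℚ` such an equation exists, Cor. 8.3), from `𝔇_min = (Δ (W₀))`
  (`WeierstrassCurve.minimalDiscriminantIdeal_eq_span_holds`) and `N ((d)) = |d|` over `ℤ`
  (`Ideal.absNorm_span_singleton`, `Algebra.norm_self`).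
* `WeierstrassCurve.valuation_Δ_eq_of_isMinimalAt_holds`: if the elliptic `W / K` is minimal at
  `v`, then `v (Δ (W)) = exp (-ord_v (Δ_min))`, i.e. `ord_v (Δ (W)) = ord_v (Δ_min)` (Silverman,
  AEC VII.1, Definition PDF p. 165 and Prop. 1.3(b)): the chosen local minimal model and
  `W ⊗ K_v` are both minimal, so their discriminants have equal valuation
  (`WeierstrassCurve.valuation_Δ_minimal_eq_of_isMinimal`), hence are associated in `O_v`
  (`IsDiscreteValuationRing.associated_of_valuation_eq`) and have equal `addVal`.
* `IsDedekindDomain.HeightOneSpectrum.exists_addVal_adicCompletionIntegers_eq`: the bridge between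
  the two normalised valuations on `O_v = v.adicCompletionIntegers K` — the additive valuation
  `IsDiscreteValuationRing.addVal O_v` of the abstract DVR (used by
  `WeierstrassCurve.ordMinimalDiscriminant`) and `Valued.v` on `K_v`, which extends `v.valuation K`:
  `addVal O_v x = n ↔ Valued.v x = exp (-n)` for `x ≠ 0`, packaged as an existence statement.

## References

* J. H. Silverman, *The Arithmetic of Elliptic Curves*, GTM 106, 2nd ed. 2009, §VIII.8, PDF p. 211
  (Definition of the minimal discriminant `𝒟_{E/K} = ∏_v 𝔭_v ^ ord_v (Δ_v)`; Definition of a global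
  minimal Weierstrass equation: `aᵢ ∈ R` and `𝒟_{E/K} = (Δ)`; Cor. 8.3: over a field of class
  number one, e.g. `ℚ`, a global minimal equation exists), and §VII.1, PDF p. 165 (Definition of
  the valuation of the minimal discriminant at `v`; Prop. 1.3(b): it is unique).
-/

open IsDedekindDomain

/-! ### The bridge `addVal O_v ↔ Valued.v` -/

namespace IsDedekindDomain.HeightOneSpectrum

open scoped WithZero

variable {A : Type*} [CommRing A] [IsDedekindDomain A] (K : Type*) [Field K]
  [Algebra A K] [IsFractionRing A K] (v : HeightOneSpectrum A)

/-- Bridge between the two normalised valuations on `O_v = v.adicCompletionIntegers K`: for a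
nonzero `x ∈ O_v` with `addVal O_v x = n` one has `Valued.v x = exp (-n)` in `ℤᵐ⁰`. Proof: pick a
uniformizer `π` of the rank-one discrete valuation `Valued.v` on `K_v` (it is surjective, so
`Valued.v π = exp (-1)`), which generates the maximal ideal of `O_v` and is therefore irreducible;
write `x = u * π ^ n`.
(Dot-notation extension of the Mathlib namespace `IsDedekindDomain.HeightOneSpectrum`.) [folklore] -/
theorem exists_addVal_adicCompletionIntegers_eq (x : v.adicCompletionIntegers K) (hx : x ≠ 0) :
    ∃ n : ℕ, IsDiscreteValuationRing.addVal (v.adicCompletionIntegers K) x = n ∧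
      Valued.v (x : v.adicCompletion K) = WithZero.exp (-(n : ℤ)) := by
  obtain ⟨π, hπU⟩ := Valuation.exists_isUniformizer_of_isCyclic_of_nontrivial
    (Valued.v : Valuation (v.adicCompletion K) ℤᵐ⁰)
  set ϖ : v.adicCompletionIntegers K := ⟨(π : v.adicCompletion K), π.2⟩ with hϖdef
  have hmax : IsLocalRing.maximalIdeal (v.adicCompletionIntegers K) = Ideal.span {ϖ} :=
    hπU.is_generator
  have hπ : Irreducible ϖ :=
    (IsDiscreteValuationRing.irreducible_iff_uniformizer _).mpr hmax
  obtain ⟨n, u, hxu⟩ := IsDiscreteValuationRing.eq_unit_mul_pow_irreducible hx hπ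
  refine ⟨n, IsDiscreteValuationRing.addVal_def x u hπ n hxu, ?_⟩
  have hu : Valued.v ((u : v.adicCompletionIntegers K) : v.adicCompletion K) = 1 :=
    adicCompletionIntegers.isUnit_iff_valued_eq_one.mp u.isUnit
  have hπv : Valued.v (ϖ : v.adicCompletion K) = WithZero.exp (-1 : ℤ) := by
    have := hπU
    rw [Valuation.IsUniformizer.iff,
      Valuation.IsRankOneDiscrete.generator_eq_exp_neg_one_of_surjective
        (valuedAdicCompletion_surjective K v)] at this
    simpa [hϖdef] using this
  rw [hxu]
  push_cast
  rw [map_mul, map_pow, hu, hπv, one_mul, ← WithZero.exp_nsmul]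
  simp

end IsDedekindDomain.HeightOneSpectrum

namespace WeierstrassCurve

/-! ### `ord_v (Δ_min)` for an equation minimal at `v` -/

section LocalDischarge

open scoped WithZero

variable {A : Type*} [CommRing A] [IsDedekindDomain A] {K : Type*} [Field K]
  [Algebra A K] [IsFractionRing A K] (v : HeightOneSpectrum A) (W : WeierstrassCurve K)

/-- **Discharge** of the named fact `WeierstrassCurve.valuation_Δ_eq_of_isMinimalAt`: if `W / K` is
elliptic and minimal at `v`, then `v (Δ (W)) = exp (-ord_v (Δ_min))`, i.e.
`ord_v (Δ (W)) = ord_v (Δ_min)`. Silverman, AEC VII.1, Definition (PDF p. 165: "this minimal value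
of `v(Δ)` is called the valuation of the minimal discriminant") and Prop. 1.3(b) (it is unique).
Proof: the chosen local minimal model `M = W.localMinimalModel v` and `W.baseChange K_v` are both
minimal, so their discriminants have equal valuation (`valuation_Δ_minimal_eq_of_isMinimal`); hence
the discriminant of the integral model of `M` and (a lift to `O_v` of) `Δ (W)` are associated in
`O_v` (`IsDiscreteValuationRing.associated_of_valuation_eq`) and have the same `addVal`; conclude
with the bridge `IsDedekindDomain.HeightOneSpectrum.exists_addVal_adicCompletionIntegers_eq` and
`valuedAdicCompletion_eq_valuation'`.
[cite: SilvermanAEC2009, VII.1 Prop. 1.3] -/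
theorem valuation_Δ_eq_of_isMinimalAt_holds : valuation_Δ_eq_of_isMinimalAt (v := v) (W := W) := by
  intro _ h
  set Ov := v.adicCompletionIntegers K
  set Kv := v.adicCompletion K
  haveI : (W.baseChange Kv).IsMinimal Ov := h
  have hval : HeightOneSpectrum.valuation Kv (IsDiscreteValuationRing.maximalIdeal Ov)
        (W.localMinimalModel v).Δ =
      HeightOneSpectrum.valuation Kv (IsDiscreteValuationRing.maximalIdeal Ov)
        (W.baseChange Kv).Δ :=
    valuation_Δ_minimal_eq_of_isMinimal Ov (W.baseChange Kv)
  have hMΔ : algebraMap Ov Kv (W.localMinimalIntegralModel v).Δ = (W.localMinimalModel v).Δ :=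
    integralModel_Δ_eq Ov _
  obtain ⟨r₀, hr₀⟩ := Δ_integral_of_isIntegral Ov (W.baseChange Kv)
  have hWΔ : (W.baseChange Kv).Δ = ((W.Δ : K) : Kv) := by
    rw [baseChange, map_Δ]
    rfl
  rw [← hMΔ, ← hr₀] at hval
  obtain ⟨u, hu⟩ := IsDiscreteValuationRing.associated_of_valuation_eq _ _ hval
  rw [Units.smul_def, Algebra.smul_def, ← map_mul] at hu
  have hu' := FaithfulSMul.algebraMap_injective Ov Kv hu
  have hassoc : Associated (W.localMinimalIntegralModel v).Δ r₀ := ⟨u, by rw [mul_comm]; exact hu'⟩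
  have haddVal := (IsDiscreteValuationRing.addVal_eq_iff_associated _ _).mpr hassoc
  have hΔ0 : ((W.Δ : K) : Kv) ≠ 0 := by
    rw [← hWΔ, baseChange, map_Δ]
    exact (W.isUnit_Δ.map _).ne_zero
  have hr₀0 : r₀ ≠ 0 := by
    rintro rfl
    rw [map_zero, hWΔ] at hr₀
    exact hΔ0 hr₀.symm
  obtain ⟨n, hn, hvn⟩ := HeightOneSpectrum.exists_addVal_adicCompletionIntegers_eq K v r₀ hr₀0
  have hr₀K : (r₀ : Kv) = ((W.Δ : K) : Kv) := by rw [← hWΔ, ← hr₀]; rfl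
  rw [hr₀K, HeightOneSpectrum.valuedAdicCompletion_eq_valuation'] at hvn
  rw [hvn, ordMinimalDiscriminant, haddVal, hn]
  simp

end LocalDischarge

/-! ### `N (𝔇_min) = |Δ|` for an equation over `ℤ` minimal at every prime -/

section RatDischarge

/-- **Discharge** of the named fact `WeierstrassCurve.minimalDiscriminantNorm_eq_natAbs`: over
`ℤ ⊆ ℚ`, for an integral Weierstrass equation `W₀ / ℤ` with `Δ ≠ 0` that is minimal at every prime,
`N (𝔇_min) = |Δ (W₀)|`. Silverman, AEC VIII.8, PDF p. 211 (Definition of `𝒟_{E/K}`; a global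
minimal Weierstrass equation has `𝒟_{E/K} = (Δ)`; over `ℚ` such an equation exists, Cor. 8.3):
this is `minimalDiscriminantIdeal_eq_span_holds` for `A = ℤ`, combined with
`Ideal.absNorm_span_singleton` and `Algebra.norm_self` (`N ((d)) = |d|` for `d ∈ ℤ`).
[cite: SilvermanAEC2009, VIII.8 (Definitions preceding Lemma 8.1, PDF p. 211) and Cor. 8.3] -/
theorem minimalDiscriminantNorm_eq_natAbs_holds : minimalDiscriminantNorm_eq_natAbs := by
  intro W₀ hΔ h
  unfold minimalDiscriminantNorm
  rw [minimalDiscriminantIdeal_eq_span_holds ℤ (K := ℚ) W₀ hΔ h,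
    Ideal.absNorm_span_singleton, Algebra.norm_self]
  rfl

end RatDischarge

end WeierstrassCurve
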